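import Summits.NavierStokesRegularity.NavierStokesRegularity.Theorems.HubbleDynamoNoSelfExcitedDynamoStubEnstrophyEvolution
import Summits.NavierStokesRegularity.NavierStokesRegularity.Theorems.HubbleDynamoNoSelfExcitedDynamoStubEnstrophyBalance
import Summits.NavierStokesRegularity.NavierStokesRegularity.Theorems.HubbleDynamoNoSelfExcitedDynamoStubBackwardGronwall
import Summits.NavierStokesRegularity.NavierStokesRegularity.Theorems.HubbleDynamoNoSelfExcitedDynamoStubCurlFreeLiouville
import Summits.NavierStokesRegularity.NavierStokesRegularity.Theorems.HubbleDynamoNoSelfExcitedDynamoBackusRegime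
import Literature.Analysis.FluidPDE.AncientSimilarityVorticity
import Literature.Analysis.FluidPDE.ParabolicComparison
import HarnessLib

/-!
# Crux `NoSelfExcitedDynamo` (stmt-NavierStokesRegularity-1934), line `registered` (v17):
# the strain (Childress-type anti-dynamo) regime, stub `stub_strainRegime`

Theorems file (lands `--supports stmt-NavierStokesRegularity-1934`). For an ETERNAL classical
solution `(W, Q)` of Leray's backward system `∂ₛW + ½W + ½(y·∇)W + (W·∇)W + ∇Q = ΔW`, `div W = 0`
on `ℝ × ℝ³` (`IsBackwardLeraySolutionOn univ 1 W Q`) in the uniform profile class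
`(1 + ‖y‖)^{k+1}‖DᵏW(s)‖ ≤ K_k`, a uniform bound on the rate of strain below the self-similar
vorticity rate, `⟪v, DW(s, y)v⟫ ≤ μ‖v‖²` with `μ < 1`, forces `W ≡ 0` (`stub_strainRegime`).

## Proof (vorticity maximum principle in similarity variables)

The vorticity `Ω = curl W` obeys `∂ₛΩ + Ω + ½(y·∇)Ω + (W·∇)Ω = (Ω·∇)W + ΔΩ`
(`IsBackwardLeraySolutionOn.vorticity_eq`). In the profile class `|Ω(s, y)|² ≤ (κK)²(1+|y|)⁻⁴`
(`enstrophy_slice_integrable`), so the continuous slice `|Ω(s, ·)|²` attains its maximum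
`m(s) = |Ω(s, y*(s))|²` (`strain_exists_max`), and `|⟪∂ₛΩ, Ω⟫| ≤ A(1+|y|)⁻⁴ ≤ A`
(`evolution_dominator`) makes every `s ↦ |Ω(s, y)|²` `2A`-Lipschitz, hence `m` is Lipschitz. At the
maximiser `y*` of `|Ω(s, ·)|²` the scalar function `⟪Ω(s, y*), Ω(s, ·)⟫` is also maximal, so
`⟪Ω, (v·∇)Ω⟫(y*) = 0` and `⟪Ω, ΔΩ⟫(y*) ≤ 0` (`strain_maxPoint`, from `IsLocalMax.fderiv = 0` and
`IsLocalMax.laplacian_nonpos`), whence by the vorticity equation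
`∂ₛ|Ω(s, y*)|² = 2⟪Ω, ∂ₛΩ⟫ ≤ 2(μ − 1)|Ω|² = −2(1 − μ)m(s)`; since `m(s') ≥ |Ω(s', y*)|²` for `s' < s`
with equality at `s`, the left slopes of `m` at `s` are eventually below any `r > −2(1 − μ)m(s)`.
A bounded continuous function with this one-sided backward growth vanishes
(`strain_leftDini_nonpos`: time reversal and Mathlib's fencing lemma
`image_le_of_liminf_slope_right_lt_deriv_boundary` against the line `−a − ½ca(σ − σ₀)`), so
`Ω ≡ 0` and the curl-free Liouville theorem `stub_curlFreeLiouville` gives `W ≡ 0`.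

The file also records the elementary quarter-threshold version `strainRegime_quarter` (`μ < ¼`):
the enstrophy identity `E(s₁) − E(s₀) = 2∫(S − D_F − ¼E)` (`stub_enstrophyEvolution`) with
`S ≤ μE`, `D_F ≥ 0` feeds the backward Grönwall lemma `stub_backwardGronwall`.
-/

noncomputable section

-- the mandated stub namespace repeats `NavierStokesRegularity` (tree precedent for this crux's stubs)
set_option linter.dupNamespace false

namespace Summit.NavierStokesRegularity.NavierStokesRegularity.Theorems.NoSelfExcitedDynamo.Registered

open Set MeasureTheory Filter Topology InnerProductSpace Function
open scoped RealInnerProductSpace NNReal ENNReal ContDiff Laplacian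
open Literature.Analysis.FluidPDE

/-! ### (A) The quarter threshold from the enstrophy identity -/

/-- **Strain regime, quarter threshold.** An eternal backward-Leray flow in the uniform profile
class with `⟪v, DW v⟫ ≤ μ‖v‖²`, `μ < ¼`, vanishes identically: with `μ' = max μ 0` the stretching
integral obeys `S = ∫⟪Ω, (DW)Ω⟫ ≤ μ'E`, the Frobenius dissipation is nonnegative, so the enstrophy
identity `E(s₁) − E(s₀) = 2∫_{s₀}^{s₁}(S − D_F − ¼E)` (`stub_enstrophyEvolution`) gives
`E(s₁) − E(s₀) ≤ −2(¼ − μ')∫_{s₀}^{s₁}E`; the backward Grönwall lemma kills the bounded enstrophy,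
the continuous integrand `‖curl W(s)‖²` vanishes, and `stub_curlFreeLiouville` finishes. -/
theorem strainRegime_quarter :
    ∀ (W : ℝ → EuclideanSpace ℝ (Fin 3) → EuclideanSpace ℝ (Fin 3)) (Q : ℝ → EuclideanSpace ℝ (Fin 3) → ℝ),
      IsBackwardLeraySolutionOn univ 1 W Q →
      (∀ k : ℕ, ∃ K : ℝ, ∀ s y, (1 + ‖y‖) ^ (k + 1) * ‖iteratedFDeriv ℝ k (W s) y‖ ≤ K) →
      (∃ μ : ℝ, μ < 1 / 4 ∧ ∀ s y (v : EuclideanSpace ℝ (Fin 3)), ⟪v, fderiv ℝ (W s) y v⟫ ≤ μ * ‖v‖ ^ 2) →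
      ∀ s y, W s y = 0 := by
  intro W Q h hdec hμ
  obtain ⟨μ, hμ4, hstrain⟩ := hμ
  -- normalise the constant: `0 ≤ μ' < 1/4`
  set μ' : ℝ := max μ 0 with hμ'
  have hμ'4 : μ' < 1 / 4 := max_lt hμ4 (by norm_num)
  have hstrain' : ∀ s y (v : EuclideanSpace ℝ (Fin 3)), ⟪v, fderiv ℝ (W s) y v⟫ ≤ μ' * ‖v‖ ^ 2 :=
    fun s y v => (hstrain s y v).trans (mul_le_mul_of_nonneg_right (le_max_left _ _) (sq_nonneg _))
  have hsm : IsSmoothSpaceTimeOn univ W := h.smooth_velocity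
  have hW3 : ∀ s, ContDiff ℝ 3 (W s) := fun s => (hsm.contDiff_slice (mem_univ s)).of_le (by norm_cast)
  obtain ⟨K, hK0, hK⟩ := enstrophy_decay hW3 hdec
  obtain ⟨hint, ⟨M, hM⟩, ⟨B, hB⟩, hId⟩ := stub_enstrophyEvolution W Q h hdec
  -- the enstrophy is continuous (Lipschitz) in `s`
  have hEc : Continuous fun s => ∫ y, ‖curl (W s) y‖ ^ 2 := by
    refine (LipschitzWith.of_le_add_mul' (f := fun s => ∫ y, ‖curl (W s) y‖ ^ 2) B fun s s' => ?_).continuous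
    rw [Real.dist_eq]
    linarith [hB s' s, le_abs_self ((∫ y, ‖curl (W s) y‖ ^ 2) - ∫ y, ‖curl (W s') y‖ ^ 2)]
  -- the slice inequality `S − D_F − ¼E ≤ −(¼ − μ')E`
  have hslice : ∀ s, (∫ y, ⟪curl (W s) y, fderiv ℝ (W s) y (curl (W s) y)⟫) -
      (∫ y, frobeniusNormSq (fderiv ℝ (curl (W s)) y)) - (1 / 4) * ∫ y, ‖curl (W s) y‖ ^ 2 ≤
      -(1 / 4 - μ') * ∫ y, ‖curl (W s) y‖ ^ 2 := by
    intro s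
    obtain ⟨i1, -, i3, -⟩ := enstrophy_slice_integrable (hW3 s) hK0 (hK s)
    have hS : (∫ y, ⟪curl (W s) y, fderiv ℝ (W s) y (curl (W s) y)⟫) ≤ μ' * ∫ y, ‖curl (W s) y‖ ^ 2 := by
      calc (∫ y, ⟪curl (W s) y, fderiv ℝ (W s) y (curl (W s) y)⟫)
          ≤ ∫ y, μ' * ‖curl (W s) y‖ ^ 2 := integral_mono i3 (i1.const_mul μ') fun y => hstrain' s y _
        _ = μ' * ∫ y, ‖curl (W s) y‖ ^ 2 := integral_const_mul _ _
    have hD : 0 ≤ ∫ y, frobeniusNormSq (fderiv ℝ (curl (W s)) y) :=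
      integral_nonneg fun y => frobeniusNormSq_nonneg _
    linarith
  -- the increment inequality and the backward Grönwall lemma
  have hc : 0 < 2 * (1 / 4 - μ') := by linarith
  have hincr : ∀ s₀ s₁ : ℝ, s₀ ≤ s₁ →
      (∫ y, ‖curl (W s₁) y‖ ^ 2) - (∫ y, ‖curl (W s₀) y‖ ^ 2) ≤
        -(2 * (1 / 4 - μ')) * ∫ s in s₀..s₁, (∫ y, ‖curl (W s) y‖ ^ 2) := by
    intro s₀ s₁ hle
    obtain ⟨hI, hId'⟩ := hId s₀ s₁ hle
    have hmono := intervalIntegral.integral_mono_on hle hI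
      (((hEc.intervalIntegrable s₀ s₁).const_mul (-(1 / 4 - μ')))) fun s _ => hslice s
    rw [intervalIntegral.integral_const_mul] at hmono
    linarith
  have hE : ∀ s, (∫ y, ‖curl (W s) y‖ ^ 2) = 0 :=
    stub_backwardGronwall (fun s => ∫ y, ‖curl (W s) y‖ ^ 2) (2 * (1 / 4 - μ')) M hc
      (fun s => integral_nonneg fun y => sq_nonneg _) hM hincr
  -- hence the vorticity vanishes, and the curl-free Liouville theorem finishes
  have hcurl : ∀ s y, curl (W s) y = 0 := fun s =>
    backusRegime_eq_zero_of_integral_sq_norm_eq_zero (PineauVicol2026.contDiff_two_curl (hW3 s)).continuous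
      (hint s) (hE s)
  exact stub_curlFreeLiouville W Q h hdec hcurl

/-! ### (B) Pure real analysis: a bounded continuous function with backward exponential growth vanishes -/

/-- **Backward Dini lemma.** Let `m : ℝ → ℝ` be continuous and bounded above, `c > 0`, and suppose
that at every `s` the left slopes `(m(s') − m(s))/(s' − s)`, `s' ↑ s`, are eventually below every
`r > −c·m(s)` (an upper bound `D⁻m(s) ≤ −c·m(s)` on the upper-left Dini derivative). Then `m ≤ 0`.
Proof: if `m(s₀) = a > 0`, the time-reversed `f(σ) = −m(−σ)` is continuous with right lower Dini
slopes `≤ c·f`, and Mathlib's fencing lemma `image_le_of_liminf_slope_right_lt_deriv_boundary`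
keeps `f` below the line `B(σ) = −a − ½ca(σ + s₀)` on `[−s₀, ∞)`, contradicting boundedness. -/
theorem strain_leftDini_nonpos {m : ℝ → ℝ} {c M : ℝ} (hc : 0 < c) (hm : Continuous m)
    (hM : ∀ s, m s ≤ M) (hD : ∀ s r, -(c * m s) < r → ∀ᶠ s' in 𝓝[<] s, slope m s s' < r) :
    ∀ s, m s ≤ 0 := by
  by_contra hneg
  push Not at hneg
  obtain ⟨s₀, hs₀⟩ := hneg
  -- time reversal `f σ = -m (-σ)`
  obtain ⟨f, hf⟩ : ∃ f : ℝ → ℝ, ∀ σ, f σ = -m (-σ) := ⟨fun σ => -m (-σ), fun σ => rfl⟩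
  have hfc : Continuous f := by
    have : f = fun σ => -m (-σ) := funext hf
    rw [this]; exact (hm.comp continuous_neg).neg
  have hf' : ∀ σ r, c * f σ < r → ∃ᶠ z in 𝓝[>] σ, slope f σ z < r := by
    intro σ r hr
    have h1 : ∀ᶠ s' in 𝓝[<] (-σ), slope m (-σ) s' < r := hD (-σ) r (by rw [hf] at hr; linarith)
    have h2 : ∀ᶠ z in 𝓝[>] σ, slope m (-σ) (-z) < r := tendsto_neg_nhdsGT.eventually h1
    refine (h2.mono fun z hz => ?_).frequently
    rw [slope_def_field] at hz ⊢
    rw [hf, hf, show (-m (-z) - -m (-σ)) / (z - σ) = (m (-z) - m (-σ)) / (-z - -σ) by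
      rw [show -z - -σ = -(z - σ) by ring, div_neg]; ring]
    exact hz
  -- the comparison line on `[σ₀, b]`
  have ha : 0 < m s₀ := hs₀
  have hMpos : 0 < M := lt_of_lt_of_le hs₀ (hM s₀)
  have hca : 0 < c * m s₀ := mul_pos hc ha
  set σ₀ : ℝ := -s₀ with hσ₀
  set b : ℝ := σ₀ + 2 * (M + 1) / (c * m s₀) with hb
  have hab : σ₀ ≤ b := by
    have : 0 ≤ 2 * (M + 1) / (c * m s₀) := by positivity
    linarith
  obtain ⟨B, hB⟩ : ∃ B : ℝ → ℝ, ∀ x, B x = -m s₀ + -(c * m s₀ / 2) * (x - σ₀) :=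
    ⟨fun x => -m s₀ + -(c * m s₀ / 2) * (x - σ₀), fun x => rfl⟩
  have hBd : ∀ x, HasDerivAt B (-(c * m s₀ / 2)) x := by
    intro x
    have e : B = fun x => -m s₀ + -(c * m s₀ / 2) * (x - σ₀) := funext hB
    have := (((hasDerivAt_id x).sub_const σ₀).const_mul (-(c * m s₀ / 2))).const_add (-m s₀)
    rw [e]
    simpa using this
  have hcmp := image_le_of_liminf_slope_right_lt_deriv_boundary (f := f) (f' := fun σ => c * f σ)
    (a := σ₀) (b := b) hfc.continuousOn (fun x _ r hr => hf' x r hr) (B := B) (B' := fun _ => -(c * m s₀ / 2))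
    (by rw [hf, hB, hσ₀, neg_neg]; simp) hBd
    (fun x hx hfx => by
      show c * f x < -(c * m s₀ / 2)
      rw [hfx, hB]
      have hx0 : 0 ≤ x - σ₀ := by linarith [hx.1]
      nlinarith [mul_nonneg hca.le hx0])
  have h1 : f b ≤ B b := hcmp (right_mem_Icc.2 hab)
  have h2 : B b = -m s₀ - (M + 1) := by
    rw [hB, hb]
    field_simp
    ring
  have h3 : -M ≤ f b := by rw [hf]; linarith [hM (-b)]
  linarith

/-! ### (B) The two conditions at a maximum point of `|Ω|²` -/

/-- **First- and second-order conditions at a maximum of `|Ω|²`.** If `Ω ∈ C²(ℝ³; ℝ³)` and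
`|Ω(y)|² ≤ |Ω(x)|²` for all `y`, then `⟪Ω(x), DΩ(x)v⟫ = 0` for every `v` and `⟪Ω(x), ΔΩ(x)⟫ ≤ 0`:
the scalar function `θ = ⟪Ω(x), Ω(·)⟫` has a maximum at `x` (Cauchy–Schwarz), so `Dθ(x) = 0`
(`IsLocalMax.hasFDerivAt_eq_zero`) and `Δθ(x) ≤ 0` (`IsLocalMax.laplacian_nonpos`), and `D`, `Δ`
commute with the functional `⟪Ω(x), ·⟫` (`ContDiffAt.laplacian_CLM_comp_left`). -/
theorem strain_maxPoint {Ω : EuclideanSpace ℝ (Fin 3) → EuclideanSpace ℝ (Fin 3)} (hΩ : ContDiff ℝ 2 Ω)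
    {x : EuclideanSpace ℝ (Fin 3)} (hmax : ∀ y, ‖Ω y‖ ^ 2 ≤ ‖Ω x‖ ^ 2) :
    (∀ v, ⟪Ω x, fderiv ℝ Ω x v⟫ = 0) ∧ ⟪Ω x, (Δ Ω) x⟫ ≤ 0 := by
  have hθmax : IsLocalMax (⇑(innerSL ℝ (Ω x)) ∘ Ω) x := by
    refine Filter.Eventually.of_forall fun y => ?_
    have hy : ‖Ω y‖ ≤ ‖Ω x‖ :=
      (pow_le_pow_iff_left₀ (norm_nonneg _) (norm_nonneg _) two_ne_zero).1 (hmax y)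
    simp only [Function.comp_apply, innerSL_apply_apply]
    calc ⟪Ω x, Ω y⟫ ≤ ‖Ω x‖ * ‖Ω y‖ := real_inner_le_norm _ _
      _ ≤ ‖Ω x‖ * ‖Ω x‖ := by gcongr
      _ = ⟪Ω x, Ω x⟫ := (real_inner_self_eq_norm_mul_norm _).symm
  have hθ2 : ContDiff ℝ 2 (⇑(innerSL ℝ (Ω x)) ∘ Ω) := (innerSL ℝ (Ω x)).contDiff.comp hΩ
  refine ⟨fun v => ?_, ?_⟩
  · have hfd : HasFDerivAt (⇑(innerSL ℝ (Ω x)) ∘ Ω) ((innerSL ℝ (Ω x)).comp (fderiv ℝ Ω x)) x :=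
      (innerSL ℝ (Ω x)).hasFDerivAt.comp x ((hΩ.differentiable two_ne_zero) x).hasFDerivAt
    have h0 := hθmax.hasFDerivAt_eq_zero hfd
    simpa using congrArg (fun L : EuclideanSpace ℝ (Fin 3) →L[ℝ] ℝ => L v) h0
  · have h1 := IsLocalMax.laplacian_nonpos hθ2 hθmax
    rwa [ContDiffAt.laplacian_CLM_comp_left hΩ.contDiffAt, Function.comp_apply,
      innerSL_apply_apply] at h1

/-! ### (B) Existence of a maximiser of a decaying continuous nonnegative function -/

/-- A continuous nonnegative function on `ℝ³` with `f(y) ≤ C(1+|y|)⁻⁴` attains its supremum: either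
`f ≡ 0` (any point), or `f(y₀) > 0` and `f ≤ f(y₀)` off a compact set
(`Continuous.exists_forall_ge'`). -/
theorem strain_exists_max {f : EuclideanSpace ℝ (Fin 3) → ℝ} (hf : Continuous f) {C : ℝ}
    (hdec : ∀ y, f y ≤ C * ((1 + ‖y‖) ^ 4)⁻¹) (h0 : ∀ y, 0 ≤ f y) : ∃ x, ∀ y, f y ≤ f x := by
  by_cases hpos : ∃ y₀, 0 < f y₀
  · obtain ⟨y₀, hy₀⟩ := hpos
    refine hf.exists_forall_ge' y₀ ?_
    have hR : ∀ᶠ y in cocompact (EuclideanSpace ℝ (Fin 3)), C / f y₀ ≤ ‖y‖ :=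
      tendsto_norm_cocompact_atTop.eventually_ge_atTop _
    filter_upwards [hR] with y hy
    have h1 : C ≤ ‖y‖ * f y₀ := (div_le_iff₀ hy₀).1 hy
    have h2 : ‖y‖ ≤ (1 + ‖y‖) ^ 4 := by
      have h1y : (1 : ℝ) ≤ 1 + ‖y‖ := by linarith [norm_nonneg y]
      calc ‖y‖ ≤ 1 + ‖y‖ := by linarith
        _ ≤ (1 + ‖y‖) ^ 4 := le_self_pow₀ h1y (by norm_num)
    calc f y ≤ C * ((1 + ‖y‖) ^ 4)⁻¹ := hdec y
      _ ≤ (‖y‖ * f y₀) * ((1 + ‖y‖) ^ 4)⁻¹ := mul_le_mul_of_nonneg_right h1 (by positivity)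
      _ ≤ ((1 + ‖y‖) ^ 4 * f y₀) * ((1 + ‖y‖) ^ 4)⁻¹ :=
          mul_le_mul_of_nonneg_right (mul_le_mul_of_nonneg_right h2 hy₀.le) (by positivity)
      _ = f y₀ := by
          rw [mul_comm ((1 + ‖y‖) ^ 4), mul_assoc, mul_inv_cancel₀ (by positivity), mul_one]
  · push Not at hpos
    exact ⟨0, fun y => (hpos y).trans (h0 0)⟩

/-! ### (B) The stub: full threshold `μ < 1` -/

/-- **The strain regime** (registered sub-goal `stub_strainRegime` of crux
stmt-NavierStokesRegularity-1934, line `registered`, v17; a Childress-type anti-dynamo bound). An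
eternal classical solution `(W, Q)` of Leray's backward system on `ℝ × ℝ³` in the uniform profile
class whose rate of strain obeys `⟪v, DW(s, y)v⟫ ≤ μ‖v‖²` for all `s, y, v` with `μ < 1` vanishes
identically. Vorticity maximum principle in similarity variables: the attained maximum
`m(s) = max_y |curl W(s, y)|²` is bounded and Lipschitz, and at a maximiser the vorticity equation
`∂ₛΩ + Ω + ½(y·∇)Ω + (W·∇)Ω = (Ω·∇)W + ΔΩ` gives `∂ₛ|Ω|² ≤ 2(μ − 1)|Ω|²` (transport terms vanish,
`⟪Ω, ΔΩ⟫ ≤ 0`, stretching `≤ μ|Ω|²`), i.e. `D⁻m ≤ −2(1 − μ)m`; the backward Dini lemma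
`strain_leftDini_nonpos` forces `m ≡ 0`, so `curl W ≡ 0` and `stub_curlFreeLiouville` concludes. -/
theorem stub_strainRegime :
    ∀ (W : ℝ → EuclideanSpace ℝ (Fin 3) → EuclideanSpace ℝ (Fin 3)) (Q : ℝ → EuclideanSpace ℝ (Fin 3) → ℝ),
      IsBackwardLeraySolutionOn univ 1 W Q →
      (∀ k : ℕ, ∃ K : ℝ, ∀ s y, (1 + ‖y‖) ^ (k + 1) * ‖iteratedFDeriv ℝ k (W s) y‖ ≤ K) →
      (∃ μ : ℝ, μ < 1 ∧ ∀ s y (v : EuclideanSpace ℝ (Fin 3)), ⟪v, fderiv ℝ (W s) y v⟫ ≤ μ * ‖v‖ ^ 2) →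
      ∀ s y, W s y = 0 := by
  intro W Q h hdec hμ
  obtain ⟨μ, hμ1, hstrain⟩ := hμ
  have hsm : IsSmoothSpaceTimeOn univ W := h.smooth_velocity
  have hW3 : ∀ s, ContDiff ℝ 3 (W s) := fun s => (hsm.contDiff_slice (mem_univ s)).of_le (by norm_cast)
  obtain ⟨K, hK0, hK⟩ := enstrophy_decay hW3 hdec
  -- pointwise decay and continuity of `|Ω|²` on every slice; maximisers
  have hΩ2 : ∀ s y, ‖curl (W s) y‖ ^ 2 ≤ (‖curlCLM‖ * K) ^ 2 * ((1 + ‖y‖) ^ 4)⁻¹ := fun s =>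
    (enstrophy_slice_integrable (hW3 s) hK0 (hK s)).2.2.2.2.2.2.2
  have hΩc : ∀ s, Continuous (curl (W s)) := fun s => (PineauVicol2026.contDiff_two_curl (hW3 s)).continuous
  have hmax : ∀ s, ∃ x, ∀ y, ‖curl (W s) y‖ ^ 2 ≤ ‖curl (W s) x‖ ^ 2 := fun s =>
    strain_exists_max ((hΩc s).norm.pow 2) (hΩ2 s) fun y => sq_nonneg _
  choose ys hys using hmax
  obtain ⟨m, hm⟩ : ∃ m : ℝ → ℝ, ∀ s, m s = ‖curl (W s) (ys s)‖ ^ 2 := ⟨_, fun s => rfl⟩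
  -- the time derivative of `|Ω(·, y)|²` and its uniform bound
  have hΩsm : IsSmoothSpaceTimeOn univ (vorticity W) := hsm.isSmoothSpaceTimeOn_vorticity uniqueDiffOn_univ
  have hderiv : ∀ s y, HasDerivAt (fun s => ‖curl (W s) y‖ ^ 2)
      (2 * ⟪curl (W s) y, timeDerivWithin univ (vorticity W) s y⟫) s := by
    intro s y
    have h1 : HasDerivAt (fun s => vorticity W s y) (timeDerivWithin univ (vorticity W) s y) s :=
      hasDerivWithinAt_univ.1 (hΩsm.hasDerivWithinAt_timeDerivWithin uniqueDiffOn_univ (mem_univ s) y)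
    have h2 := h1.norm_sq
    simp only [vorticity_apply] at h2
    exact h2
  obtain ⟨A, hA0, hdomA⟩ : ∃ A : ℝ, 0 ≤ A ∧ ∀ s y,
      |⟪timeDerivWithin univ (vorticity W) s y, curl (W s) y⟫| ≤ A * ((1 + ‖y‖) ^ 4)⁻¹ :=
    ⟨_, by positivity, fun s y => evolution_dominator h s hK0 (hK s) y⟩
  have hdom : ∀ s y, ‖2 * ⟪curl (W s) y, timeDerivWithin univ (vorticity W) s y⟫‖ ≤ 2 * A := by
    intro s y
    have h1y : ((1 + ‖y‖) ^ 4)⁻¹ ≤ (1 : ℝ) :=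
      inv_le_one_of_one_le₀ (one_le_pow₀ (by linarith [norm_nonneg y]))
    have h2 := hdomA s y
    rw [real_inner_comm] at h2
    rw [Real.norm_eq_abs, abs_mul, abs_two]
    nlinarith [mul_le_mul_of_nonneg_left h1y hA0]
  -- `|Ω(·, y)|²` is `2A`-Lipschitz, uniformly in `y`; hence `m` is continuous
  have hlip : ∀ y s s', ‖curl (W s') y‖ ^ 2 ≤ ‖curl (W s) y‖ ^ 2 + 2 * A * dist s' s := by
    intro y s s'
    have e := convex_univ.norm_image_sub_le_of_norm_hasDerivWithin_le (f := fun s => ‖curl (W s) y‖ ^ 2)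
      (fun x _ => (hderiv x y).hasDerivWithinAt) (fun x _ => hdom x y) (mem_univ s) (mem_univ s')
    rw [Real.norm_eq_abs, Real.norm_eq_abs] at e
    rw [Real.dist_eq]
    linarith [le_abs_self (‖curl (W s') y‖ ^ 2 - ‖curl (W s) y‖ ^ 2)]
  have hmc : Continuous m := by
    refine (LipschitzWith.of_le_add_mul' (2 * A) fun s' s => ?_).continuous
    rw [hm, hm]
    linarith [hlip (ys s') s s', hys s (ys s')]
  -- `m` is bounded
  have hmM : ∀ s, m s ≤ (‖curlCLM‖ * K) ^ 2 := by
    intro s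
    rw [hm]
    have h1y : ((1 + ‖ys s‖) ^ 4)⁻¹ ≤ (1 : ℝ) :=
      inv_le_one_of_one_le₀ (one_le_pow₀ (by linarith [norm_nonneg (ys s)]))
    exact (hΩ2 s (ys s)).trans (mul_le_of_le_one_right (sq_nonneg _) h1y)
  -- the key one-sided estimate `D⁻m(s) ≤ −2(1 − μ)m(s)` at a maximiser
  have hD : ∀ s r, -(2 * (1 - μ) * m s) < r → ∀ᶠ s' in 𝓝[<] s, slope m s s' < r := by
    intro s r hr
    have hΩ2s : ContDiff ℝ 2 (curl (W s)) := PineauVicol2026.contDiff_two_curl (hW3 s)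
    obtain ⟨hfirst, hsecond⟩ := strain_maxPoint hΩ2s (hys s)
    -- the vorticity equation at `(s, ys s)`
    have eq := h.vorticity_eq uniqueDiffOn_univ (by simp) (mem_univ s) (ys s)
    simp only [vorticity_apply, convect_apply, one_smul] at eq
    have e' : timeDerivWithin univ (vorticity W) s (ys s) =
        fderiv ℝ (W s) (ys s) (curl (W s) (ys s)) + (Δ (curl (W s))) (ys s) - curl (W s) (ys s)
          - (1 / 2 : ℝ) • fderiv ℝ (curl (W s)) (ys s) (ys s) - fderiv ℝ (curl (W s)) (ys s) (W s (ys s)) := by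
      rw [← eq]; abel
    have key : 2 * ⟪curl (W s) (ys s), timeDerivWithin univ (vorticity W) s (ys s)⟫ ≤ -(2 * (1 - μ) * m s) := by
      rw [e']
      simp only [inner_add_right, inner_sub_right, inner_smul_right, hfirst, real_inner_self_eq_norm_sq]
      have hst := hstrain s (ys s) (curl (W s) (ys s))
      rw [hm]
      nlinarith [hsecond]
    -- left slopes of `s' ↦ |Ω(s', ys s)|²` tend to the derivative, and dominate those of `m`
    have hg : Tendsto (slope (fun s' => ‖curl (W s') (ys s)‖ ^ 2) s) (𝓝[<] s)
        (𝓝 (2 * ⟪curl (W s) (ys s), timeDerivWithin univ (vorticity W) s (ys s)⟫)) :=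
      (hasDerivWithinAt_iff_tendsto_slope' (by simp)).1 (hderiv s (ys s)).hasDerivWithinAt
    have hev : ∀ᶠ s' in 𝓝[<] s, slope (fun s' => ‖curl (W s') (ys s)‖ ^ 2) s s' < r :=
      hg.eventually (gt_mem_nhds (key.trans_lt hr))
    filter_upwards [hev, self_mem_nhdsWithin] with s' h1 h2
    refine lt_of_le_of_lt ?_ h1
    rw [slope_def_field, slope_def_field]
    refine div_le_div_of_nonpos_of_le (sub_nonpos.2 (le_of_lt h2)) ?_
    rw [hm, hm]
    linarith [hys s' (ys s)]
  have hm0 : ∀ s, m s ≤ 0 :=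
    strain_leftDini_nonpos (c := 2 * (1 - μ)) (by linarith) hmc hmM hD
  -- conclusion: `curl W ≡ 0`, then the curl-free Liouville theorem
  have hcurl : ∀ s y, curl (W s) y = 0 := by
    intro s y
    have h1 : ‖curl (W s) y‖ ^ 2 ≤ 0 := (hys s y).trans ((hm s).symm.le.trans (hm0 s))
    have h2 : ‖curl (W s) y‖ ^ 2 = 0 := le_antisymm h1 (sq_nonneg _)
    simpa using h2
  exact stub_curlFreeLiouville W Q h hdec hcurl

end Summit.NavierStokesRegularity.NavierStokesRegularity.Theorems.NoSelfExcitedDynamo.Registered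

end
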